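import Mathlib
import Summits.QuantumFields.YangMills.Theorems.SpecificationCompactnessGibbsLimitUniquenessDoeblin
import Literature.MathematicalPhysics.QuantumLattice.GaugeLinkResampling
import HarnessLib

/-!
# Route `SpecificationCompactness`, LINE 15 «cocycle_limit» (crux `SpecificationLimitAE`, stmt-QuantumFields-22688) — kernel 2 of STUB B
# `stub_specificationFromCocycle`: THE COCYCLE IDENTITY PASSES TO THE LIMIT AND NORMALISES `q = (∫ R_∞ dh)⁻¹`

Generic measure theory on a finite product `(ι → G, Π = ⊗_ι η)`, `η` a probability measure.  For positive (a.e.) integrable densities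
`u_K` the one-link likelihood ratios `R_K(W,h) = u_K(W[e↦h])/u_K(W)` satisfy the COCYCLE identity
`R_K(W[e↦h'],h)·R_K(W,h') = R_K(W,h)` for a.e. `(W,h',h)` (`cocycle_ae`); if `R_K → R_∞` in `(Π ⊗ η)`-measure with `R_∞ > 0` a.e. and
integrable fibres a.e., then the identity passes to the limit (`limit_cocycle_ae`, transport along the three measure-preserving maps
`(W,h',h) ↦ (W,h), (W,h'), (W[e↦h'],h)` — the tree's `GaugeLinkResampling.measurePreserving_update`), hence with `I(W) = ∫ R_∞(W,h) dη(h)`: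
`I(W[e↦h'])·R_∞(W,h') = I(W)` a.e. (`fibreIntegral_update_mul`), `I > 0` a.e., and `q := I⁻¹` has `∫ q(W[e↦h']) dη(h') = 1` a.e., is
integrable, and is FIBRE-NORMALISED: `Π[q | links ≠ e] = 1` a.e. (`condExp_invFibreIntegral_eq_one`, via
`GibbsLimitUniqueness.condExp_pi_ae_eq_integral_update`).  This is step 5 of the planner's STUB-PLAN (ym-idea-5 g10); cell `ym-idea-1`
width seat `ym-line-sfw-p2-w3` gen 27 (free hands).  HONEST FRAMING: pure measure theory; rung R3 RECORD line; no crux, route, rung or mass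
gap is proved.  Sources: O. Kallenberg, *Foundations of Modern Probability* (2002), Thm 6.4, Lemma 4.11; [SalmhoferSeiler1991] §2 (2.12)
(resampling one link preserves product Haar).
-/

noncomputable section

namespace Summit.QuantumFields.YangMills.Theorems.SpecificationCompactnessCocycleNormalisation

open MeasureTheory Filter Topology Function Set
open scoped ENNReal
open Summit.QuantumFields.YangMills.Theorems.GibbsLimitUniqueness (condExp_pi_ae_eq_integral_update)
open Literature.MathematicalPhysics.QuantumLattice (measurePreserving_update)

section Product

variable {ι : Type*} [Fintype ι] [DecidableEq ι] {G : Type*} [MeasurableSpace G] (η : Measure G) [IsProbabilityMeasure η] (e : ι)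

/-- The three measure-preserving maps `(W,h',h) ↦ (W,h)`, `(W,h') `, `(W[e↦h'],h)` from `(Π ⊗ η) ⊗ η` to `Π ⊗ η`.
[cite: SalmhoferSeiler1991, §2 (2.12)] -/
theorem measurePreserving_triple :
    MeasurePreserving (fun t : ((ι → G) × G) × G => (t.1.1, t.2))
      (((Measure.pi fun _ : ι => η).prod η).prod η) ((Measure.pi fun _ : ι => η).prod η) ∧
    MeasurePreserving (fun t : ((ι → G) × G) × G => t.1)
      (((Measure.pi fun _ : ι => η).prod η).prod η) ((Measure.pi fun _ : ι => η).prod η) ∧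
    MeasurePreserving (fun t : ((ι → G) × G) × G => (update t.1.1 e t.1.2, t.2))
      (((Measure.pi fun _ : ι => η).prod η).prod η) ((Measure.pi fun _ : ι => η).prod η) := by
  refine ⟨?_, measurePreserving_fst, ?_⟩
  · exact (measurePreserving_fst (μ := Measure.pi fun _ : ι => η) (ν := η)).prod (MeasurePreserving.id η)
  · exact (measurePreserving_update η e).prod (MeasurePreserving.id η)

/-- **THE ONE-LINK LIKELIHOOD RATIOS FORM A COCYCLE (a.e.)**: for a density `u > 0` `Π`-a.e.,
`R(W[e↦h'],h)·R(W,h') = R(W,h)` with `R(W,h) = u(W[e↦h])/u(W)`, for `(Π⊗η)⊗η`-a.e. `(W,h',h)`. [cite: Kallenberg2002, Thm 6.4] -/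
theorem cocycle_ae (u : (ι → G) → ℝ) (hupos : ∀ᵐ W ∂(Measure.pi fun _ : ι => η), 0 < u W) :
    ∀ᵐ t ∂(((Measure.pi fun _ : ι => η).prod η).prod η),
      (u (update (update t.1.1 e t.1.2) e t.2) / u (update t.1.1 e t.1.2)) * (u (update t.1.1 e t.1.2) / u t.1.1) =
        u (update t.1.1 e t.2) / u t.1.1 := by
  obtain ⟨h1, h2, h3⟩ := measurePreserving_triple η e
  have hA : ∀ᵐ t ∂(((Measure.pi fun _ : ι => η).prod η).prod η), 0 < u t.1.1 :=
    (h2.quasiMeasurePreserving.ae ((measurePreserving_fst (μ := Measure.pi fun _ : ι => η) (ν := η)).quasiMeasurePreserving.ae hupos))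
  have hB : ∀ᵐ t ∂(((Measure.pi fun _ : ι => η).prod η).prod η), 0 < u (update t.1.1 e t.1.2) :=
    h2.quasiMeasurePreserving.ae ((measurePreserving_update η e).quasiMeasurePreserving.ae hupos)
  filter_upwards [hA, hB] with t ha hb
  rw [update_idem]
  field_simp

/-- **THE COCYCLE IDENTITY PASSES TO THE IN-MEASURE LIMIT**: if `R_K(W,h) = u_K(W[e↦h])/u_K(W) → R_∞` in `(Π ⊗ η)`-measure with all
`u_K > 0` a.e., then `R_∞(W[e↦h'],h)·R_∞(W,h') = R_∞(W,h)` for `(Π⊗η)⊗η`-a.e. `(W,h',h)` (a.e.-convergent subsequence transported along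
the three measure-preserving maps). [cite: Kallenberg2002, Lemma 4.11] -/
theorem limit_cocycle_ae (u : ℕ → (ι → G) → ℝ) (hupos : ∀ K, ∀ᵐ W ∂(Measure.pi fun _ : ι => η), 0 < u K W)
    (Rinf : (ι → G) × G → ℝ)
    (hlim : TendstoInMeasure ((Measure.pi fun _ : ι => η).prod η)
      (fun K z => u K (update z.1 e z.2) / u K z.1) atTop Rinf) :
    ∀ᵐ t ∂(((Measure.pi fun _ : ι => η).prod η).prod η),
      Rinf (update t.1.1 e t.1.2, t.2) * Rinf (t.1.1, t.1.2) = Rinf (t.1.1, t.2) := by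
  obtain ⟨ns, -, hae⟩ := hlim.exists_seq_tendsto_ae
  obtain ⟨h1, h2, h3⟩ := measurePreserving_triple η e
  have hc : ∀ᵐ t ∂(((Measure.pi fun _ : ι => η).prod η).prod η), ∀ K,
      (u K (update (update t.1.1 e t.1.2) e t.2) / u K (update t.1.1 e t.1.2)) * (u K (update t.1.1 e t.1.2) / u K t.1.1) =
        u K (update t.1.1 e t.2) / u K t.1.1 := by
    rw [ae_all_iff]; intro K; exact cocycle_ae η e (u K) (hupos K)
  filter_upwards [hc, h1.quasiMeasurePreserving.ae hae, h2.quasiMeasurePreserving.ae hae, h3.quasiMeasurePreserving.ae hae]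
    with t ht hl1 hl2 hl3
  -- the three limits at the three arguments
  have hprod : Tendsto (fun i => (u (ns i) (update (update t.1.1 e t.1.2) e t.2) / u (ns i) (update t.1.1 e t.1.2)) *
      (u (ns i) (update t.1.1 e t.1.2) / u (ns i) t.1.1)) atTop (𝓝 (Rinf (update t.1.1 e t.1.2, t.2) * Rinf (t.1.1, t.1.2))) :=
    hl3.mul hl2
  have heq : (fun i => (u (ns i) (update (update t.1.1 e t.1.2) e t.2) / u (ns i) (update t.1.1 e t.1.2)) *
      (u (ns i) (update t.1.1 e t.1.2) / u (ns i) t.1.1)) = fun i => u (ns i) (update t.1.1 e t.2) / u (ns i) t.1.1 :=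
    funext fun i => ht (ns i)
  rw [heq] at hprod
  exact tendsto_nhds_unique hprod hl1

/-- **INTEGRATING THE LIMIT COCYCLE IN `h`**: with `I(W) = ∫ R_∞(W,h) dη(h)` and integrable fibres a.e., `I(W[e↦h'])·R_∞(W,h') = I(W)`
for `Π⊗η`-a.e. `(W,h')`. [cite: Kallenberg2002, Thm 6.4] -/
theorem fibreIntegral_update_mul (Rinf : (ι → G) × G → ℝ)
    (hcoc : ∀ᵐ t ∂(((Measure.pi fun _ : ι => η).prod η).prod η),
      Rinf (update t.1.1 e t.1.2, t.2) * Rinf (t.1.1, t.1.2) = Rinf (t.1.1, t.2)) :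
    ∀ᵐ z ∂((Measure.pi fun _ : ι => η).prod η),
      (∫ h, Rinf (update z.1 e z.2, h) ∂η) * Rinf z = ∫ h, Rinf (z.1, h) ∂η := by
  have h1 : ∀ᵐ z ∂((Measure.pi fun _ : ι => η).prod η), ∀ᵐ h ∂η,
      Rinf (update z.1 e z.2, h) * Rinf (z.1, z.2) = Rinf (z.1, h) := Measure.ae_ae_of_ae_prod hcoc
  filter_upwards [h1] with z hz
  rw [← integral_mul_const]
  exact integral_congr_ae hz

omit [DecidableEq ι] in
/-- **POSITIVITY OF THE LIMIT FIBRE INTEGRALS**: `R_∞ > 0` a.e. with integrable fibres a.e. gives `I(W) = ∫ R_∞(W,h) dη > 0` for a.e. `W`.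
[folklore] -/
theorem fibreIntegral_pos_ae (Rinf : (ι → G) × G → ℝ) (hRi0 : ∀ z, 0 ≤ Rinf z)
    (hpos : ∀ᵐ z ∂((Measure.pi fun _ : ι => η).prod η), 0 < Rinf z)
    (hint : ∀ᵐ W ∂(Measure.pi fun _ : ι => η), Integrable (fun h => Rinf (W, h)) η) :
    ∀ᵐ W ∂(Measure.pi fun _ : ι => η), 0 < ∫ h, Rinf (W, h) ∂η := by
  filter_upwards [Measure.ae_ae_of_ae_prod hpos, hint] with W hW hWi
  rw [integral_pos_iff_support_of_nonneg_ae (ae_of_all _ fun h => hRi0 _) hWi]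
  rw [pos_iff_ne_zero]
  intro h0
  have h0' : ∀ᵐ h ∂η, h ∉ support fun h => Rinf (W, h) := measure_eq_zero_iff_ae_notMem.mp h0
  have : ∀ᵐ h ∂η, False := by
    filter_upwards [hW, h0'] with h hh hh'
    exact hh' (mem_support.mpr hh.ne')
  exact (ae_neBot.mpr (IsProbabilityMeasure.ne_zero η)).ne (eventually_false_iff_eq_bot.mp this)

/-- **THE LIMIT SPECIFICATION `q = I⁻¹` IS FIBRE-NORMALISED**: under the hypotheses above, for `Π`-a.e. `W`,
`∫ q(W[e↦h']) dη(h') = 1`; `q` is integrable; and `Π[q | links ≠ e] = 1` a.e. [cite: Kallenberg2002, Thm 6.4] -/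
theorem condExp_invFibreIntegral_eq_one (Rinf : (ι → G) × G → ℝ) (hRim : Measurable Rinf) (hRi0 : ∀ z, 0 ≤ Rinf z)
    (hpos : ∀ᵐ z ∂((Measure.pi fun _ : ι => η).prod η), 0 < Rinf z)
    (hcoc : ∀ᵐ t ∂(((Measure.pi fun _ : ι => η).prod η).prod η),
      Rinf (update t.1.1 e t.1.2, t.2) * Rinf (t.1.1, t.1.2) = Rinf (t.1.1, t.2))
    (hint : ∀ᵐ W ∂(Measure.pi fun _ : ι => η), Integrable (fun h => Rinf (W, h)) η) :
    (∀ᵐ W ∂(Measure.pi fun _ : ι => η), ∫ h, (∫ a, Rinf (update W e h, a) ∂η)⁻¹ ∂η = 1) ∧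
    Integrable (fun W => (∫ a, Rinf (W, a) ∂η)⁻¹) (Measure.pi fun _ : ι => η) ∧
    (∀ᵐ W ∂(Measure.pi fun _ : ι => η),
      ((Measure.pi fun _ : ι => η)[fun W => (∫ a, Rinf (W, a) ∂η)⁻¹ |
        MeasurableSpace.comap (fun (W : ι → G) (b : {b // b ≠ e}) => W b.1) MeasurableSpace.pi]) W = 1) := by
  set P : Measure (ι → G) := Measure.pi fun _ : ι => η with hP
  set I : (ι → G) → ℝ := fun W => ∫ a, Rinf (W, a) ∂η with hI
  have hIm : Measurable I := (hRim.stronglyMeasurable.integral_prod_right' (ν := η)).measurable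
  have hqm : Measurable fun W => (I W)⁻¹ := hIm.inv
  have hIpos : ∀ᵐ W ∂P, 0 < I W := fibreIntegral_pos_ae η Rinf hRi0 hpos hint
  have hupd := measurePreserving_update η e
  -- (d) `q(W[e↦h']) = R_∞(W,h')·q(W)` a.e. on `Π ⊗ η`
  have hmul := fibreIntegral_update_mul η e Rinf hcoc
  have hq_upd : ∀ᵐ z ∂(P.prod η), (I (update z.1 e z.2))⁻¹ = Rinf z * (I z.1)⁻¹ := by
    filter_upwards [hmul, hpos, (measurePreserving_fst (μ := P) (ν := η)).quasiMeasurePreserving.ae hIpos] with z hz hRz hIz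
    have hIz' : I z.1 ≠ 0 := ne_of_gt hIz
    have hRz' : Rinf z ≠ 0 := ne_of_gt hRz
    have hIu : I (update z.1 e z.2) = I z.1 / Rinf z := by
      rw [eq_div_iff hRz']; exact hz
    rw [hIu, inv_div, div_eq_mul_inv]
  -- (iii) `∫ q(W[e↦h']) dη(h') = 1` a.e.
  have hone : ∀ᵐ W ∂P, ∫ h, (I (update W e h))⁻¹ ∂η = 1 := by
    filter_upwards [Measure.ae_ae_of_ae_prod hq_upd, hIpos] with W hW hIW
    rw [integral_congr_ae hW, integral_mul_const]
    exact mul_inv_cancel₀ (ne_of_gt hIW)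
  -- (iv) integrability of `q` via the lintegral over `Π ⊗ η`
  have hqint : Integrable (fun W => (I W)⁻¹) P := by
    have hq0 : ∀ W, 0 ≤ (I W)⁻¹ := fun W => inv_nonneg.mpr (integral_nonneg fun a => hRi0 _)
    refine (lintegral_ofReal_ne_top_iff_integrable hqm.aestronglyMeasurable (ae_of_all _ hq0)).mp ?_
    have hcomp : ∫⁻ z, ENNReal.ofReal ((I (update z.1 e z.2))⁻¹) ∂(P.prod η) = ∫⁻ W, ENNReal.ofReal ((I W)⁻¹) ∂P :=
      hupd.lintegral_comp hqm.ennreal_ofReal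
    have hmeas2 : Measurable fun z : (ι → G) × G => ENNReal.ofReal ((I (update z.1 e z.2))⁻¹) :=
      hqm.ennreal_ofReal.comp measurable_update'
    rw [← hcomp, lintegral_prod (fun z : (ι → G) × G => ENNReal.ofReal ((I (update z.1 e z.2))⁻¹)) hmeas2.aemeasurable]
    have hinner : ∀ᵐ W ∂P, ∫⁻ h, ENNReal.ofReal ((I (update W e h))⁻¹) ∂η = 1 := by
      filter_upwards [hone, Measure.ae_ae_of_ae_prod hq_upd, hint] with W hW hW' hWi
      have hfi : Integrable (fun h => (I (update W e h))⁻¹) η := by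
        refine Integrable.congr ((hWi.mul_const ((I W)⁻¹))) ?_
        filter_upwards [hW'] with h hh
        exact hh.symm
      rw [← ofReal_integral_eq_lintegral_ofReal hfi (ae_of_all _ fun h => hq0 _), hW, ENNReal.ofReal_one]
    rw [lintegral_congr_ae hinner, lintegral_const, measure_univ, mul_one]
    exact ENNReal.one_ne_top
  refine ⟨hone, hqint, ?_⟩
  -- (v) the conditional expectation is the fibre integral
  have hfib := condExp_pi_ae_eq_integral_update η e hqm.stronglyMeasurable hqint
  filter_upwards [hfib, hone] with W h1 h2
  rw [h1]
  exact h2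

end Product

end Summit.QuantumFields.YangMills.Theorems.SpecificationCompactnessCocycleNormalisation

end
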